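import Summits.CriticalPhenomena.PercolationContinuityZ3.Theorems.PercNearOneGluingNoHeavyLowerTailSahiStrongCubicMax
import Mathlib.Tactic.Linarith
import Mathlib.Tactic.Ring
import Mathlib.Tactic.FinCases
import HarnessLib

/-!
# `NoHeavyLowerTail` (crux stmt-CriticalPhenomena-4575), master-family line P1 (gen 22):
# SECOND-ORDER HARRIS FOR SUNFLOWERS OF ANY SIZE — the `k`-petal one-payer conjecture (typed), `k = 2` (Harris),
# `k = 3 ⟺ S₃^max`, and monotonicity in `k`

Support file (seat `prim-masterthm-p1`, gen 22; `--supports stmt-CriticalPhenomena-4575`).  Standard axioms, no `sorry`.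
Memo `run/shared/lean/prim/prim-masterthm/FROM-prim-masterthm-p1-g22-SUNFLOWER-ONE-PAYER.md`.

SETTING (Gladkov's [cite: Gladkov2024StrongFKG, Thm. 2.1]): a `k`-SUNFLOWER of increasing events `U_0, …, U_{k−1}` of the
finite cube `Set ι` — all pairwise intersections equal to one event `K` (the kernel; `IsSunflower`).  Write
`D_i = ⋂_{j ≠ i} (U_j)ᶜ` (`petalDown`, decreasing) and `O = ⋂_j (U_j)ᶜ` (`outside`); the `D_i` form a `k`-sunflower of
decreasing events with kernel `O`.  Gladkov's Theorem 2.1 is the first-order statement `μ(K)μ(O) ≥ e₂(μ(U_i ∖ K))`.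

NEW HERE.
* **CONJECTURE (typed, `SunflowerOnePayer k p`): if `μ(O) ≤ μ(K)` then `Π_i μ(U_i) ≤ μ(K)^{k−1}`, and if `μ(K) ≤ μ(O)`
  then `Π_i μ(D_i) ≤ μ(O)^{k−1}`** ("the heavier of kernel and outside pays"; the two halves are exchanged by complementation).
  For `k = 2` both halves are Harris's inequality (`sunflowerOnePayer_two`, PROVED); for `k = 3` the statement is EXACTLY the
  seat's one-payer conjecture S₃^max in the product form of `…SahiOnePayerProductForm` (`sunflowerOnePayer_three_iff`:
  `SunflowerOnePayer 3 p ↔ StrongCubicMaxNonneg p`); and the hierarchy is MONOTONE: `SunflowerOnePayer (k+1) p → SunflowerOnePayer k p`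
  for `k ≥ 2` (`sunflowerOnePayer_of_succ`, pad with the petal-free member `U_k := K`).  First-order Harris only gives the
  exponent `k/2` (`Π μ(U_i)² ≤ μ(K)^k`); the independent `k`-coordinate system `U_i = {x_i = 1} ∪ {≥ 2 ones}` is tight on the
  outside branch at every bias (`Π μ(D_i) = (Π q_j)^{k−1} = μ(O)^{k−1}`).
* CENSUS (exact integer arithmetic, gen 22; engines `work/kpetal/sunk.c`, `sunr.c` of the seat folder): ALL sunflower partitions
  `Set (Fin n) = K ⊔ C_1 ⊔ … ⊔ C_k ⊔ O` with `n ≤ 5` and exactly `k` nonempty petals, `k = 3, 4, 5` (21.1 M / 10.1 M / 2.7 M systems)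
  × 57 bias vectors (incl. the uniform biases `j/20`), plus 3·10⁵ random antichain-generated systems on `n = 6 … 9` coins × 30–40
  bias vectors: 0 failures of the conjecture in either half (and both payers do occur alone), 0 failures of the companion
  "all-subsets" inequality `μ(K)μ(O) ≥ Σ_{|S| ≥ 2} Π_{i∈S} μ(C_i)` (`k = 3`: the seat's S₃ `κo ≥ e₂ + e₃`).
HONEST FRAMING: typed conjecture with its proved cases `k ≤ 2` and exact kernel links; S₃^max (`k = 3`) and all `k ≥ 3` remain OPEN.
[this work]
-/

noncomputable section

open scoped Classical

namespace Summit.CriticalPhenomena.PercolationContinuityZ3.Theorems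

namespace SahiDeepCore

open Literature.Combinatorics.Sahi2008
open Literature.Probability.Percolation (DeterminedBy)
open Literature.Probability.Percolation.DecisionTree (ind ind_of_mem ind_of_not_mem ind_nonneg)

variable {ι : Type} [Fintype ι]

local notation3 (prettyPrint := false) "m⟦" p ", " X "⟧" => ex (bernoulliWeight p) (ind X)

/-! ### 0. Plumbing: masses, Harris for increasing and for decreasing events -/

omit [Fintype ι] in
/-- Cell masses are nonnegative. [folklore] -/
private theorem massK_nonneg [Fintype ι] (p : ι → unitInterval) (X : Set (Set ι)) : 0 ≤ m⟦p, X⟧ :=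
  ex_nonneg (isFKGMeasure_bernoulliWeight p).nonneg fun ω => ind_nonneg _ ω

omit [Fintype ι] in
/-- `1_{U ∩ V} = 1_U · 1_V`. [folklore] -/
private theorem indK_inter_mul (U V : Set (Set ι)) : ind (U ∩ V) = ind U * ind V := by
  funext ω
  simp only [Pi.mul_apply]
  by_cases hU : ω ∈ U
  · by_cases hV : ω ∈ V
    · rw [ind_of_mem (show ω ∈ U ∩ V from ⟨hU, hV⟩), ind_of_mem hU, ind_of_mem hV]; norm_num
    · rw [ind_of_not_mem (show ω ∉ U ∩ V from fun h => hV h.2), ind_of_not_mem hV]; norm_num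
  · rw [ind_of_not_mem (show ω ∉ U ∩ V from fun h => hU h.1), ind_of_not_mem hU]; norm_num

/-- Harris for two increasing events: `μ(U)μ(V) ≤ μ(U ∩ V)`. [cite: Harris1960, Lemma 4.1] -/
private theorem harrisK_up (p : ι → unitInterval) {U V : Set (Set ι)} (hU : IsUpperSet U) (hV : IsUpperSet V) :
    m⟦p, U⟧ * m⟦p, V⟧ ≤ m⟦p, U ∩ V⟧ := by
  have h := ex_mul_ex_le_ex_mul p (monotone_ind_of_isUpperSet hU) (monotone_ind_of_isUpperSet hV)
  rwa [← indK_inter_mul] at h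

/-- Harris for two decreasing events: `μ(X)μ(Y) ≤ μ(X ∩ Y)` (the same inequality on the order dual of the cube).
[cite: Harris1960, Lemma 4.1] -/
private theorem harrisK_down (p : ι → unitInterval) {X Y : Set (Set ι)} (hX : IsLowerSet X) (hY : IsLowerSet Y) :
    m⟦p, X⟧ * m⟦p, Y⟧ ≤ m⟦p, X ∩ Y⟧ := by
  have h := Literature.Combinatorics.Sahi2008.ex_mul_ex_le_ex_mul (isFKGMeasure_bernoulliWeightDual p)
    (f := fun a => ind X (OrderDual.ofDual a)) (g := fun a => ind Y (OrderDual.ofDual a))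
    (fun a => ind_nonneg X _) (fun a => ind_nonneg Y _)
    (monotone_ind_toDual_of_isLowerSet hX) (monotone_ind_toDual_of_isLowerSet hY)
  rw [indK_inter_mul]
  exact h

/-! ### 1. Sunflowers, the complementary down-sets, and the typed conjecture -/

omit [Fintype ι] in
/-- `U_0, …, U_{k−1}` is a SUNFLOWER with kernel `K`: all pairwise intersections equal `K` (the setting of Gladkov's
strong Harris–Kleitman inequality, `H_n = K ⊔ C_1 ⊔ ⋯ ⊔ C_k ⊔ O` with `U_i = K ⊔ C_i`; a predicate, not a named fact). [this work] -/
def IsSunflower {k : ℕ} (U : Fin k → Set (Set ι)) (K : Set (Set ι)) : Prop :=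
  ∀ i j, i ≠ j → U i ∩ U j = K

omit [Fintype ι] in
/-- The complementary down-set of member `i`: `D_i = ⋂_{j ≠ i} (U_j)ᶜ` (`= O ⊔ C_i` for a sunflower). [this work] -/
def petalDown {k : ℕ} (U : Fin k → Set (Set ι)) (i : Fin k) : Set (Set ι) :=
  {ω | ∀ j, j ≠ i → ω ∉ U j}

omit [Fintype ι] in
/-- The outside `O = ⋂_j (U_j)ᶜ` of a family (the kernel of the complementary sunflower `(D_i)`). [this work] -/
def outside {k : ℕ} (U : Fin k → Set (Set ι)) : Set (Set ι) :=
  {ω | ∀ j, ω ∉ U j}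

/-- **CONJECTURE (second-order Harris for sunflowers; the `k`-petal one-payer inequality; typed).**  For every
`k`-sunflower of increasing events with kernel `K` and outside `O` under the product measure `μ_p`:
if `μ(O) ≤ μ(K)` then `Π_i μ(U_i) ≤ μ(K)^{k−1}`, and if `μ(K) ≤ μ(O)` then `Π_i μ(D_i) ≤ μ(O)^{k−1}` — the HEAVIER of kernel
and outside "pays".  `k = 2`: Harris (both halves, no hypothesis; `sunflowerOnePayer_two`).  `k = 3`: exactly S₃^max
(`sunflowerOnePayer_three_iff`).  Monotone in `k` (`sunflowerOnePayer_of_succ`).  Exact census `n ≤ 5` exhaustive for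
`k ≤ 5`, random `n ≤ 9`: 0 failures (file header). [this work] [status: open] -/
@[conjecture] def SunflowerOnePayer (k : ℕ) (p : ι → unitInterval) : Prop :=
  ∀ (U : Fin k → Set (Set ι)) (K : Set (Set ι)), (∀ i, IsUpperSet (U i)) → IsSunflower U K →
    (m⟦p, outside U⟧ ≤ m⟦p, K⟧ → ∏ i, m⟦p, U i⟧ ≤ m⟦p, K⟧ ^ (k - 1)) ∧
      (m⟦p, K⟧ ≤ m⟦p, outside U⟧ → ∏ i, m⟦p, petalDown U i⟧ ≤ m⟦p, outside U⟧ ^ (k - 1))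

/-- The conjecture implies the plain DICHOTOMY "kernel pays or outside pays". [this work] -/
theorem sunflowerOnePayer_dichotomy {k : ℕ} (p : ι → unitInterval) (h : SunflowerOnePayer k p)
    (U : Fin k → Set (Set ι)) (K : Set (Set ι)) (hU : ∀ i, IsUpperSet (U i)) (hK : IsSunflower U K) :
    ∏ i, m⟦p, U i⟧ ≤ m⟦p, K⟧ ^ (k - 1) ∨ ∏ i, m⟦p, petalDown U i⟧ ≤ m⟦p, outside U⟧ ^ (k - 1) := by
  obtain ⟨hc, ho⟩ := h U K hU hK
  rcases le_total (m⟦p, outside U⟧) (m⟦p, K⟧) with hle | hle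
  · exact Or.inl (hc hle)
  · exact Or.inr (ho hle)

omit [Fintype ι] in
/-- The complementary down-sets are decreasing events. [this work] -/
theorem isLowerSet_petalDown {k : ℕ} {U : Fin k → Set (Set ι)} (hU : ∀ i, IsUpperSet (U i)) (i : Fin k) :
    IsLowerSet (petalDown U i) := by
  intro ω ω' hle hω j hj hω'
  exact hω j hj (hU j hle hω')

omit [Fintype ι] in
/-- The outside is a decreasing event. [this work] -/
theorem isLowerSet_outside {k : ℕ} {U : Fin k → Set (Set ι)} (hU : ∀ i, IsUpperSet (U i)) :
    IsLowerSet (outside U) := by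
  intro ω ω' hle hω j hω'
  exact hω j (hU j hle hω')

omit [Fintype ι] in
/-- Two distinct complementary down-sets meet exactly in the outside (the `D_i` form a sunflower with kernel `O`). [this work] -/
theorem petalDown_inter_petalDown {k : ℕ} (U : Fin k → Set (Set ι)) {i j : Fin k} (hij : i ≠ j) :
    petalDown U i ∩ petalDown U j = outside U := by
  ext ω
  simp only [petalDown, outside, Set.mem_inter_iff, Set.mem_setOf_eq]
  constructor
  · rintro ⟨hi, hj⟩ l
    by_cases hl : l = i
    · subst hl; exact hj l hij
    · exact hi l hl
  · intro h
    exact ⟨fun l _ => h l, fun l _ => h l⟩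

omit [Fintype ι] in
/-- In a sunflower with at least two members the kernel lies in every member. [this work] -/
theorem kernel_subset_of_isSunflower {k : ℕ} {U : Fin k → Set (Set ι)} {K : Set (Set ι)} (hK : IsSunflower U K)
    {i j : Fin k} (hij : i ≠ j) : K ⊆ U i := by
  rw [← hK i j hij]
  exact Set.inter_subset_left

/-! ### 2. `k = 2`: both halves are Harris's inequality -/

/-- **`k = 2` of the conjecture holds** (unconditionally, both halves): `μ(U_0)μ(U_1) ≤ μ(U_0 ∩ U_1)` and
`μ(U_1ᶜ)μ(U_0ᶜ) ≤ μ(U_0ᶜ ∩ U_1ᶜ)` are Harris's inequality for increasing resp. decreasing events. [this work] -/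
theorem sunflowerOnePayer_two (p : ι → unitInterval) : SunflowerOnePayer 2 p := by
  intro U K hU hK
  have h01 : U 0 ∩ U 1 = K := hK 0 1 (by decide)
  refine ⟨fun _ => ?_, fun _ => ?_⟩
  · rw [Fin.prod_univ_two, show (2 - 1 : ℕ) = 1 from rfl, pow_one, ← h01]
    exact harrisK_up p (hU 0) (hU 1)
  · rw [Fin.prod_univ_two, show (2 - 1 : ℕ) = 1 from rfl, pow_one, ← petalDown_inter_petalDown U (show (0 : Fin 2) ≠ 1 by decide)]
    exact harrisK_down p (isLowerSet_petalDown hU 0) (isLowerSet_petalDown hU 1)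

/-! ### 3. Monotonicity in `k`: pad a `k`-sunflower with the petal-free member `U_k := K` -/

/-- **`SunflowerOnePayer (k+1) ⟹ SunflowerOnePayer k`** for `k ≥ 2`: appending the member `U_k := K` (empty petal) to a
`k`-sunflower gives a `(k+1)`-sunflower with the same kernel, the same outside, the same complementary down-sets, the new
one being `D_k = O`; both products pick up exactly one factor `μ(K)` resp. `μ(O)`.  (When that factor vanishes the `k`-level
inequality follows from Harris directly.) [this work] -/
theorem sunflowerOnePayer_of_succ (p : ι → unitInterval) {k : ℕ} (hk : 2 ≤ k) (h : SunflowerOnePayer (k + 1) p) :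
    SunflowerOnePayer k p := by
  intro U K hU hK
  -- two distinct indices of `Fin k`
  set i0 : Fin k := ⟨0, by omega⟩ with hi0
  set i1 : Fin k := ⟨1, by omega⟩ with hi1
  have h01 : i0 ≠ i1 := by
    intro h; have := congrArg Fin.val h; simp [hi0, hi1] at this
  have hKsub : ∀ i, K ⊆ U i := by
    intro i
    by_cases hi : i = i0
    · subst hi; exact kernel_subset_of_isSunflower hK h01
    · exact kernel_subset_of_isSunflower hK hi
  have hKup : IsUpperSet K := by rw [← hK i0 i1 h01]; exact (hU i0).inter (hU i1)
  -- the padded family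
  set V : Fin (k + 1) → Set (Set ι) := Fin.snoc U K with hV
  have hVc : ∀ i : Fin k, V (Fin.castSucc i) = U i := fun i => by simp [hV]
  have hVl : V (Fin.last k) = K := by simp [hV]
  have hVup : ∀ i, IsUpperSet (V i) := by
    intro i
    refine Fin.lastCases ?_ (fun j => ?_) i
    · rw [hVl]; exact hKup
    · rw [hVc]; exact hU j
  have hVK : IsSunflower V K := by
    intro i j hij
    induction i using Fin.lastCases with
    | last =>
      induction j using Fin.lastCases with
      | last => exact absurd rfl hij
      | cast j => rw [hVl, hVc]; exact Set.inter_eq_left.2 (hKsub j)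
    | cast i =>
      induction j using Fin.lastCases with
      | last => rw [hVl, hVc]; exact Set.inter_eq_right.2 (hKsub i)
      | cast j =>
        rw [hVc, hVc]
        exact hK i j fun h => hij (by rw [h])
  -- outside and down-sets of the padded family
  have hO : outside V = outside U := by
    ext ω
    simp only [outside, Set.mem_setOf_eq, Fin.forall_fin_succ', hVc, hVl]
    constructor
    · exact fun h => h.1
    · exact fun h => ⟨h, fun hω => h i0 (hKsub i0 hω)⟩
  have hDc : ∀ i : Fin k, petalDown V (Fin.castSucc i) = petalDown U i := by
    intro i
    ext ω
    simp only [petalDown, Set.mem_setOf_eq, Fin.forall_fin_succ', hVc, hVl]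
    constructor
    · intro h j hj
      exact h.1 j fun h' => hj (Fin.castSucc_injective _ h')
    · intro h
      refine ⟨fun j hj => h j fun h' => hj (by rw [h']), fun _ hω => ?_⟩
      -- some `j ≠ i` exists in `Fin k` (k ≥ 2); `K ⊆ U j`
      by_cases hi : i = i0
      · exact h i1 (fun h' => h01 (h'.trans hi).symm) (hKsub i1 hω)
      · exact h i0 (fun h' => hi h'.symm) (hKsub i0 hω)
  have hDl : petalDown V (Fin.last k) = outside U := by
    ext ω
    simp only [petalDown, outside, Set.mem_setOf_eq, Fin.forall_fin_succ', hVc, hVl]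
    constructor
    · intro h j
      exact h.1 j (Fin.castSucc_lt_last j).ne
    · intro h
      exact ⟨fun j _ => h j, fun h' => absurd rfl h'⟩
  obtain ⟨hc, ho⟩ := h V K hVup hVK
  have hk1 : k - 1 + 1 = k := by omega
  have hkk : (k + 1 - 1 : ℕ) = k - 1 + 1 := by omega
  refine ⟨fun hle => ?_, fun hle => ?_⟩
  · -- kernel branch
    have hc' := hc (by rwa [hO])
    rw [Fin.prod_univ_castSucc, hVl, hkk, pow_succ] at hc'
    simp only [hVc] at hc'
    by_cases hKpos : 0 < m⟦p, K⟧
    · exact le_of_mul_le_mul_right hc' hKpos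
    · have hK0 : m⟦p, K⟧ = 0 := le_antisymm (not_lt.1 hKpos) (massK_nonneg p K)
      -- Harris: μ(U i0) μ(U i1) ≤ μ(K) = 0, so one factor vanishes
      have hh := harrisK_up p (hU i0) (hU i1)
      rw [hK i0 i1 h01, hK0] at hh
      have hz : m⟦p, U i0⟧ * m⟦p, U i1⟧ = 0 :=
        le_antisymm hh (mul_nonneg (massK_nonneg p _) (massK_nonneg p _))
      have hprod : ∏ i, m⟦p, U i⟧ = 0 := by
        rcases mul_eq_zero.1 hz with h0 | h1
        · exact Finset.prod_eq_zero (Finset.mem_univ i0) h0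
        · exact Finset.prod_eq_zero (Finset.mem_univ i1) h1
      rw [hprod]
      exact pow_nonneg (massK_nonneg p K) _
  · -- outside branch
    have ho' := ho (by rwa [hO])
    rw [Fin.prod_univ_castSucc, hDl, hO, hkk, pow_succ] at ho'
    simp only [hDc] at ho'
    by_cases hOpos : 0 < m⟦p, outside U⟧
    · exact le_of_mul_le_mul_right ho' hOpos
    · have hO0 : m⟦p, outside U⟧ = 0 := le_antisymm (not_lt.1 hOpos) (massK_nonneg p _)
      have hh := harrisK_down p (isLowerSet_petalDown hU i0) (isLowerSet_petalDown hU i1)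
      rw [petalDown_inter_petalDown U h01, hO0] at hh
      have hz : m⟦p, petalDown U i0⟧ * m⟦p, petalDown U i1⟧ = 0 :=
        le_antisymm hh (mul_nonneg (massK_nonneg p _) (massK_nonneg p _))
      have hprod : ∏ i, m⟦p, petalDown U i⟧ = 0 := by
        rcases mul_eq_zero.1 hz with h0 | h1
        · exact Finset.prod_eq_zero (Finset.mem_univ i0) h0
        · exact Finset.prod_eq_zero (Finset.mem_univ i1) h1
      rw [hprod]
      exact pow_nonneg (massK_nonneg p _) _

/-- Hence every level `k ≥ 2` of the conjecture contains Harris (`k = 2`) and, for `k ≥ 3`, S₃^max (`k = 3`). [this work] -/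
theorem sunflowerOnePayer_of_le (p : ι → unitInterval) {k l : ℕ} (hk : 2 ≤ k) (hkl : k ≤ l) (h : SunflowerOnePayer l p) :
    SunflowerOnePayer k p := by
  induction l, hkl using Nat.le_induction with
  | base => exact h
  | succ l hkl ih => exact ih (sunflowerOnePayer_of_succ p (le_trans hk hkl) h)

end SahiDeepCore

end Summit.CriticalPhenomena.PercolationContinuityZ3.Theorems

end
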